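import Summits.ResolutionOfSingularities.ResolutionOfSingularities.Theorems.PurelyInseparableDim4SwapTransportTwo
import HarnessLib
import HarnessLib.Audit.Tags

/-!
# Purely inseparable four-folds — a slot-unit-class frame through a ROTATION step: the real chain blows up in the
# chart of a FREE letter and drops a slot, the virtual partner blows up in the chart of that slot (cell `res-dim4-pi`,
# K2(p) lane, slice B; K24b-R1 «rotation residual of the C∞ assembly», file `unitFrame_rotate₂`)

[OURS · counted 0 · cell `res-dim4-pi` · K2(p) lane holder res-dim4-p-12 g3's ruling (bus 2026-08-29 04:33:16Z): K24b-R1 (b)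
= res-dim4-typ-1 g3 («SN1 swap for the rotation case»); companion of `…SwapTransportTwo.unitFrame_step₂`; idea
res-dim4-idea-4 g3 §8 N4 (chart-swap re-presentation), res-dim4-p-3 g4 (A) (bus 03:37:43Z: «the SAME geometric step is
presentable as j k = u with b k λ ≠ 0»).]  Nothing here proves K2(p)/K2(5), `NoIsolatedTrap 5 5` or resolution of
singularities in dimension ≥ 4 / characteristic `p` — NOT proved.  AI kernel work, weaker than expert review.

ROTATION.  Relation `B.F = clean(Uᵖ · θ(A.F)) + E` (`E ∈ 𝔪₀ᴹ`), `θ` of slot-unit class along `π` (virtual slots `a, a′`,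
virtual free letters `g, g̃`).  The REAL chain `A` takes its step in the chart of the FREE letter `π g`, translating the slot
`π a` by `b(π a) ≠ 0` (that boundary component is left), keeping `π a′` (`b(π a′) = 0`) and translating `π g̃` freely; the SAME
closed point of the exceptional `ℙ³` is, in the virtual presentation, in the chart of the SLOT `a` with a translation `b′`
supported on `{g, g̃}` — the three 1-JET RELATIONS `hLa`, `hLg`, `hLg̃` (with the scalar `λ = e_a(0)/b(π a)`) say exactly this.
**`unitFrame_rotate₂`**: the virtual slot step `step a b′ B` and the real free-chart step `step (π g) b A` are again related by
a slot-unit-class frame, now along `π ∘ (a g)` — the real chart letter `π g` is the new virtual slot `a`, the dropped real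
slot `π a` becomes the image of the virtual free letter `g` — with error in `𝔪₀^{M − p}` and EXPLICIT tangent data (so the
invertibility of the tangent map is carried: the free `2 × 2` block is multiplied by `−e_a(0)/λ³` in determinant).  With
`unitFrame_step₂` (slot steps) this lets a virtual window of honest slot steps with FIXED letters shadow any real C∞ chain,
rotating or not.  No SN1 swap identity is needed: the cross-chart transport is proved directly, by the same congruence
`θ⁺∘α ≡ β∘θ (mod 𝔪₀ᴹ)` as SN3.
[cite: Hauser2010, §§F–G (chart expressions of a point blowup; cleaning)] [folklore]
bears_on: LADDER-RESOLUTION:D157-DOOR2 (res-dim4-pi · K2(p) · slice B · K24b-R1).  Supports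
stmt-ResolutionOfSingularities-16155 (helper).
-/

set_option linter.dupNamespace false -- mandated namespace of this single-conjunct summit

noncomputable section

namespace Summit.ResolutionOfSingularities.ResolutionOfSingularities.Theorems.PIDim4

namespace SwapTransport

open MvPolynomial Finset
open Literature.AlgebraicGeometry.Resolution
open Literature.AlgebraicGeometry.Resolution.CentreBlowup
open Literature.AlgebraicGeometry.Resolution.Hauser2010

variable {K : Type} [Field K]

/-! ## §1 Inverses of units modulo `𝔪₀ᴹ` and their linear coefficients -/

/-- Linear coefficients of a product: `coeff_{x_i}(P·Q) = P(0)·coeff_{x_i} Q + coeff_{x_i} P · Q(0)`. [folklore] -/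
theorem coeff_single_mul_add (P Q : MvPolynomial (Fin 4) K) (i : Fin 4) :
    coeff (Finsupp.single i 1) (P * Q) =
      constantCoeff P * coeff (Finsupp.single i 1) Q + coeff (Finsupp.single i 1) P * constantCoeff Q := by
  have hsplit : P * Q = P * (Q - C (constantCoeff Q)) + P * C (constantCoeff Q) := by ring
  rw [hsplit, coeff_add, NarrowApolarity.coeff_single_mul_of_constantCoeff_eq_zero P _
    (by rw [map_sub, constantCoeff_C, sub_self]), coeff_sub, coeff_C,
    if_neg (Ne.symm (Finsupp.single_ne_zero.mpr one_ne_zero)), sub_zero, mul_comm P (C _), coeff_C_mul]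
  ring

/-- **Inverse modulo `𝔪₀ᴹ`** of a polynomial with nonzero constant term (geometric sum), with its constant term and its
LINEAR coefficients: `W(0)·V(0) = 1`, `V(0)·coeff_{x_i} W = −W(0)·coeff_{x_i} V` (`M ≥ 2`). [folklore] -/
theorem exists_inv_mod_pow {V : MvPolynomial (Fin 4) K} (hV : constantCoeff V ≠ 0) {M : ℕ} (hM : 2 ≤ M) :
    ∃ W : MvPolynomial (Fin 4) K, constantCoeff W * constantCoeff V = 1 ∧ W * V - 1 ∈ originIdeal K ^ M ∧
      ∀ i, constantCoeff V * coeff (Finsupp.single i 1) W = -(constantCoeff W * coeff (Finsupp.single i 1) V) := by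
  obtain ⟨c, hc⟩ : ∃ c : K, c = constantCoeff V := ⟨_, rfl⟩
  rw [← hc] at hV
  obtain ⟨q, hq⟩ : ∃ q : MvPolynomial (Fin 4) K, q = -(C c⁻¹ * (V - C c)) := ⟨_, rfl⟩
  have hq0 : constantCoeff q = 0 := by
    rw [hq, map_neg, map_mul, map_sub, constantCoeff_C, constantCoeff_C, ← hc, sub_self, mul_zero, neg_zero]
  have hVq : V = C c * (1 - q) := by
    rw [hq, mul_sub, mul_one, mul_neg, ← mul_assoc, ← C_mul, mul_inv_cancel₀ hV, C_1, one_mul]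
    ring
  have hW0 : constantCoeff (C c⁻¹ * ∑ k ∈ Finset.range (M + 1), q ^ k) = c⁻¹ := by
    rw [map_mul, constantCoeff_C, map_sum, Finset.sum_range_succ', pow_zero, map_one,
      Finset.sum_eq_zero (fun k _ => by rw [pow_succ, map_mul, hq0, mul_zero]), zero_add, mul_one]
  have hinv : (C c⁻¹ * ∑ k ∈ Finset.range (M + 1), q ^ k) * V - 1 ∈ originIdeal K ^ M := by
    rw [hVq, show C c⁻¹ * (∑ k ∈ Finset.range (M + 1), q ^ k) * (C c * (1 - q)) =
        (C c⁻¹ * C c) * ((1 - q) * ∑ k ∈ Finset.range (M + 1), q ^ k) by ring, mul_neg_geom_sum, ← C_mul,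
      inv_mul_cancel₀ hV, C_1, one_mul, sub_sub_cancel_left]
    refine Submodule.neg_mem _ (Ideal.pow_le_pow_right (Nat.le_succ M) (Ideal.pow_mem_pow ?_ _))
    exact (NarrowApolarity.mem_originIdeal_iff q).mpr hq0
  refine ⟨C c⁻¹ * ∑ k ∈ Finset.range (M + 1), q ^ k, ?_, hinv, fun i => ?_⟩
  · rw [hW0, ← hc, inv_mul_cancel₀ hV]
  · -- the linear coefficient of `W·V − 1 ∈ 𝔪₀ᴹ`, `M ≥ 2`, vanishes
    have h0 : coeff (Finsupp.single i 1) ((C c⁻¹ * ∑ k ∈ Finset.range (M + 1), q ^ k) * V - 1) = 0 :=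
      (IsolationCert.mem_originIdeal_pow_iff M _).mp hinv _ (by rw [Finsupp.degree_single]; omega)
    rw [coeff_sub, coeff_one, if_neg (Ne.symm (Finsupp.single_ne_zero.mpr one_ne_zero)), sub_zero,
      coeff_single_mul_add, hW0, ← hc] at h0
    rw [hW0, ← hc]
    linear_combination h0

/-- The four letters exhaust `Fin 4` (numeric form for `omega`). [folklore] -/
theorem letters4 {a a' g gt : Fin 4} (haa' : a ≠ a') (hag : a ≠ g) (hagt : a ≠ gt) (ha'g : a' ≠ g) (ha'gt : a' ≠ gt)
    (hggt : g ≠ gt) (i : Fin 4) : i = a ∨ i = a' ∨ i = g ∨ i = gt := by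
  revert a a' g gt i
  decide

/-! ## §2 THE TRANSPORT of a two-letter slot-unit-class frame through a rotation step -/

/-- **Slot-unit-class frame through a ROTATION step** (`unitFrame_rotate₂`; K24b-R1).  Virtual letters `a, a′` (slots),
`g, g̃` (free), pairwise distinct; `π` virtual ↦ real.  Class: `θ(x_{π a}) = x_a e_a`, `θ(x_{π a′}) = x_{a′} e_{a′}` (units),
`θ(x_{π g})(0) = θ(x_{π g̃})(0) = 0`.  Real step in the chart `π g` with translation `b` (`b(π g) = 0`, `b(π a′) = 0`); virtual
step in the chart `a` with translation `b′` (`b′ a = b′ a′ = 0`); point correspondence through the scalar `λ`: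
`λ·b(π a) = e_a(0)` (so `b(π a) ≠ 0`: the slot `π a` IS dropped), `∂_aθ_g(0) + ∂_gθ_g(0)·b′_g + ∂_g̃θ_g(0)·b′_g̃ = λ`,
`∂_aθ_g̃(0) + ∂_gθ_g̃(0)·b′_g + ∂_g̃θ_g̃(0)·b′_g̃ = λ·b(π g̃)`.  Then the children are related by a slot-unit-class frame
`θ′` along `π ∘ (a g)`: `θ′(x_{π g}) = x_a·e′_a`, `θ′(x_{π a′}) = x_{a′}·e′_{a′}` (units), `θ′(x_{π a})(0) = θ′(x_{π g̃})(0) = 0`,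
error in `𝔪₀^{M − p}`, with tangent data `e′_a(0) = λ`, `λ·e′_{a′}(0) = e_{a′}(0)`,
`λ²·coeff_{x_k} θ′(x_{π a}) = −e_a(0)·coeff_{x_k} θ(x_{π g})`, `λ·coeff_{x_k} θ′(x_{π g̃}) = coeff_{x_k} θ(x_{π g̃}) −
b(π g̃)·coeff_{x_k} θ(x_{π g})` (`k ≠ a`). [OURS] [cite: Hauser2010, §§F–G] -/
theorem unitFrame_rotate₂ (p : ℕ) [Fact p.Prime] [CharP K p] [DecidableEq K] (π : Equiv.Perm (Fin 4))
    {a a' g gt : Fin 4} (haa' : a ≠ a') (hag : a ≠ g) (hagt : a ≠ gt) (ha'g : a' ≠ g) (ha'gt : a' ≠ gt)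
    (hggt : g ≠ gt) {M : ℕ} (hM2 : 2 ≤ M) {A B : State K} {θ e : Fin 4 → MvPolynomial (Fin 4) K}
    {U E : MvPolynomial (Fin 4) K}
    (hθa : θ (π a) = X a * e a) (hθa' : θ (π a') = X a' * e a') (hea : constantCoeff (e a) ≠ 0)
    (hea' : constantCoeff (e a') ≠ 0) (hg0 : constantCoeff (θ (π g)) = 0) (hgt0 : constantCoeff (θ (π gt)) = 0)
    (hU : constantCoeff U ≠ 0) (hE : E ∈ originIdeal K ^ M)
    (hrel : B.F = deletePthPowers p (U ^ p * aeval θ A.F) + E)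
    (hA : (p : ℕ∞) ≤ ordAlong Finset.univ A.F) (hB : (p : ℕ∞) ≤ ordAlong Finset.univ B.F)
    {b b' : Fin 4 → K} (hbg : b (π g) = 0) (hba' : b (π a') = 0) (hb'a : b' a = 0) (hb'a' : b' a' = 0) {lam : K}
    (hLa : lam * b (π a) = constantCoeff (e a))
    (hLg : coeff (Finsupp.single a 1) (θ (π g)) + coeff (Finsupp.single g 1) (θ (π g)) * b' g +
      coeff (Finsupp.single gt 1) (θ (π g)) * b' gt = lam)
    (hLgt : coeff (Finsupp.single a 1) (θ (π gt)) + coeff (Finsupp.single g 1) (θ (π gt)) * b' g +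
      coeff (Finsupp.single gt 1) (θ (π gt)) * b' gt = lam * b (π gt)) :
    ∃ (θ' e' : Fin 4 → MvPolynomial (Fin 4) K) (U' E' : MvPolynomial (Fin 4) K),
      θ' (π g) = X a * e' a ∧ θ' (π a') = X a' * e' a' ∧ constantCoeff (e' a) ≠ 0 ∧ constantCoeff (e' a') ≠ 0 ∧
      constantCoeff (θ' (π a)) = 0 ∧ constantCoeff (θ' (π gt)) = 0 ∧ constantCoeff U' ≠ 0 ∧
      E' ∈ originIdeal K ^ (M - p) ∧
      (step p Finset.univ a b' B).F =
        deletePthPowers p (U' ^ p * aeval θ' (step p Finset.univ (π g) b A).F) + E' ∧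
      constantCoeff (e' a) = lam ∧ lam * constantCoeff (e' a') = constantCoeff (e a') ∧
      (∀ k, k ≠ a → lam ^ 2 * coeff (Finsupp.single k 1) (θ' (π a)) =
        -(constantCoeff (e a) * coeff (Finsupp.single k 1) (θ (π g)))) ∧
      (∀ k, k ≠ a → lam * coeff (Finsupp.single k 1) (θ' (π gt)) =
        coeff (Finsupp.single k 1) (θ (π gt)) - b (π gt) * coeff (Finsupp.single k 1) (θ (π g))) := by
  classical
  have hπag : π a ≠ π g := fun h => hag (π.injective h)
  have hπa'g : π a' ≠ π g := fun h => ha'g (π.injective h)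
  have hπgtg : π gt ≠ π g := fun h => hggt.symm (π.injective h)
  have hπgta : π gt ≠ π a := fun h => hagt.symm (π.injective h)
  have hπa'a : π a' ≠ π a := fun h => haa'.symm (π.injective h)
  have hπa'gt : π a' ≠ π gt := fun h => ha'gt (π.injective h)
  -- `λ ≠ 0` and the dropped slot
  have hlam : lam ≠ 0 := by
    intro h; rw [h, zero_mul] at hLa; exact hea hLa.symm
  -- the two blow-up substitutions: virtual chart `a`, real chart `π g`
  obtain ⟨β, hβ⟩ : ∃ β : Fin 4 → MvPolynomial (Fin 4) K,
      β = fun i => if i = a then (X a : MvPolynomial (Fin 4) K) else X a * (X i + C (b' i)) := ⟨_, rfl⟩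
  obtain ⟨α, hα⟩ : ∃ α : Fin 4 → MvPolynomial (Fin 4) K,
      α = fun i => if i = π g then (X (π g) : MvPolynomial (Fin 4) K) else X (π g) * (X i + C (b i)) := ⟨_, rfl⟩
  have hβa : β a = X a := by rw [hβ]; simp
  have hβk : ∀ k, k ≠ a → β k = X a * (X k + C (b' k)) := fun k hk => by rw [hβ]; simp [hk]
  have hαg : α (π g) = X (π g) := by rw [hα]; simp
  have hαk : ∀ k, k ≠ π g → α k = X (π g) * (X k + C (b k)) := fun k hk => by rw [hα]; simp [hk]
  have hβ0 : ∀ i, constantCoeff (β i) = 0 := fun i => by rw [hβ]; exact constantCoeff_blowup a b' i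
  -- the chart identities
  have hBch : aeval β B.F = X a ^ p * PointBlowup.translate b' (chartTransform p Finset.univ a B.F) := by
    rw [hβ]; exact FreeTailProof.aeval_blowup_eq p a b' hb'a B.F hB
  have hAch : aeval α A.F = X (π g) ^ p * PointBlowup.translate b (chartTransform p Finset.univ (π g) A.F) := by
    rw [hα]; exact FreeTailProof.aeval_blowup_eq p (π g) b hbg A.F hA
  -- `β` keeps constant terms, its images are flat along `x_a`
  have hεc : ∀ H : MvPolynomial (Fin 4) K, constantCoeff (aeval β H) = constantCoeff H :=
    fun H => CoordChange.constantCoeff_aeval_of_origin β hβ0 H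
  have hεflat : ∀ H : MvPolynomial (Fin 4) K,
      aeval β H - C (constantCoeff H) ∈ Ideal.span {(X a : MvPolynomial (Fin 4) K)} := fun H => by
    have h := aeval_blowup_sub_C_mem a b' H
    rwa [← hβ] at h
  -- the images of the two free letters divided by `x_a`
  obtain ⟨Qg, hQgβ, hQg0, hQg1⟩ := exists_blowup_factor (ℓ := a) b' hg0
  obtain ⟨Qt, hQtβ, hQt0, hQt1⟩ := exists_blowup_factor (ℓ := a) b' hgt0
  rw [← hβ] at hQgβ hQtβ
  have hsum : ∀ G : MvPolynomial (Fin 4) K, ∑ i ∈ Finset.univ.erase a, coeff (Finsupp.single i 1) G * b' i =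
      coeff (Finsupp.single g 1) G * b' g + coeff (Finsupp.single gt 1) G * b' gt := by
    intro G
    have hgm : g ∈ Finset.univ.erase a := Finset.mem_erase.mpr ⟨hag.symm, Finset.mem_univ g⟩
    have hgtm : gt ∈ Finset.univ.erase a := Finset.mem_erase.mpr ⟨hagt.symm, Finset.mem_univ gt⟩
    refine Finset.sum_eq_add_of_mem g gt hgm hgtm hggt fun i hi hne => ?_
    have hia : i ≠ a := Finset.ne_of_mem_erase hi
    -- the remaining letter is `a′`
    have hia' : i = a' := by
      by_contra h
      have := letters4 haa' hag hagt ha'g ha'gt hggt i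
      omega
    rw [hia', hb'a', mul_zero]
  have hQg0' : constantCoeff Qg = lam := by rw [hQg0, hsum, ← hLg, add_assoc]
  have hQt0' : constantCoeff Qt = lam * b (π gt) := by rw [hQt0, hsum, ← hLgt, add_assoc]
  -- the inverse `W` of `Q_g` modulo `𝔪₀ᴹ`
  obtain ⟨W, hWc, hWinv, hWlin⟩ := exists_inv_mod_pow (V := Qg) (by rw [hQg0']; exact hlam) hM2
  rw [hQg0'] at hWc hWlin
  obtain ⟨w, hw⟩ : ∃ w : K, w = constantCoeff W := ⟨_, rfl⟩
  rw [← hw] at hWc hWlin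
  have hwne : w ≠ 0 := left_ne_zero_of_mul_eq_one hWc
  -- the new data
  obtain ⟨e', he'⟩ : ∃ e' : Fin 4 → MvPolynomial (Fin 4) K,
      e' = fun i => if i = a then Qg else aeval β (e i) * W := ⟨_, rfl⟩
  obtain ⟨θ', hθ'⟩ : ∃ θ' : Fin 4 → MvPolynomial (Fin 4) K,
      θ' = fun k => if k = π g then X a * Qg else if k = π a then aeval β (e a) * W - C (b (π a))
        else if k = π gt then Qt * W - C (b (π gt)) else X a' * (aeval β (e a') * W) := ⟨_, rfl⟩
  obtain ⟨U', hU'⟩ : ∃ U' : MvPolynomial (Fin 4) K, U' = aeval β U * Qg := ⟨_, rfl⟩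
  have he'a : e' a = Qg := by rw [he']; simp
  have he'a' : e' a' = aeval β (e a') * W := by rw [he']; simp [haa'.symm]
  have hθ'g : θ' (π g) = X a * Qg := by rw [hθ']; dsimp only; rw [if_pos rfl]
  have hθ'a : θ' (π a) = aeval β (e a) * W - C (b (π a)) := by
    rw [hθ']; dsimp only; rw [if_neg hπag, if_pos rfl]
  have hθ'gt : θ' (π gt) = Qt * W - C (b (π gt)) := by
    rw [hθ']; dsimp only; rw [if_neg hπgtg, if_neg hπgta, if_pos rfl]
  have hθ'a' : θ' (π a') = X a' * (aeval β (e a') * W) := by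
    rw [hθ']; dsimp only; rw [if_neg hπa'g, if_neg hπa'a, if_neg hπa'gt]
  -- the letterwise congruence `θ⁺∘α ≡ β∘θ mod 𝔪₀ᴹ`
  have hΘ : ∀ k, aeval θ' (α k) - aeval β (θ k) ∈ originIdeal K ^ M := by
    intro k
    obtain ⟨i, rfl⟩ := π.surjective k
    rcases letters4 haa' hag hagt ha'g ha'gt hggt i with h | h | h | h <;> rw [h]
    · -- `i = a`: the dropped slot
      rw [hαk _ hπag, map_mul, map_add, aeval_X, aeval_X, aeval_C, algebraMap_eq, hθ'g, hθ'a, hθa, map_mul, aeval_X,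
        hβa, sub_add_cancel]
      rw [show X a * Qg * (aeval β (e a) * W) - X a * aeval β (e a) = X a * aeval β (e a) * (W * Qg - 1) by ring]
      exact Ideal.mul_mem_left _ _ hWinv
    · -- `i = a′`: the kept slot
      rw [hαk _ hπa'g, map_mul, map_add, aeval_X, aeval_X, aeval_C, algebraMap_eq, hθ'g, hθ'a', hba', C_0, add_zero,
        hθa', map_mul, aeval_X, hβk a' haa'.symm, hb'a', C_0, add_zero]
      rw [show X a * Qg * (X a' * (aeval β (e a') * W)) - X a * X a' * aeval β (e a') =
          X a * X a' * aeval β (e a') * (W * Qg - 1) by ring]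
      exact Ideal.mul_mem_left _ _ hWinv
    · -- `i = g`: the real chart letter
      rw [hαg, aeval_X, hθ'g, hQgβ, sub_self]
      exact Submodule.zero_mem _
    · -- `i = g̃`: the other free letter
      rw [hαk _ hπgtg, map_mul, map_add, aeval_X, aeval_X, aeval_C, algebraMap_eq, hθ'g, hθ'gt, hQtβ, sub_add_cancel]
      rw [show X a * Qg * (Qt * W) - X a * Qt = X a * Qt * (W * Qg - 1) by ring]
      exact Ideal.mul_mem_left _ _ hWinv
  have hD : aeval (fun k => aeval θ' (α k)) A.F - aeval (fun k => aeval β (θ k)) A.F ∈ originIdeal K ^ M :=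
    ApproxCoordChange.aeval_sub_aeval_mem hΘ A.F
  -- abbreviations for the two point transforms and the error
  obtain ⟨TA, hTA⟩ : ∃ TA : MvPolynomial (Fin 4) K,
      TA = PointBlowup.translate b (chartTransform p Finset.univ (π g) A.F) := ⟨_, rfl⟩
  obtain ⟨TB, hTB⟩ : ∃ TB : MvPolynomial (Fin 4) K,
      TB = PointBlowup.translate b' (chartTransform p Finset.univ a B.F) := ⟨_, rfl⟩
  have hstepB : (step p Finset.univ a b' B).F = deletePthPowers p TB := by rw [hTB]; rfl
  have hstepA : (step p Finset.univ (π g) b A).F = deletePthPowers p TA := by rw [hTA]; rfl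
  rw [← hTB] at hBch
  rw [← hTA] at hAch
  obtain ⟨D, hDdef⟩ : ∃ D : MvPolynomial (Fin 4) K,
      D = aeval (fun k => aeval θ' (α k)) A.F - aeval (fun k => aeval β (θ k)) A.F := ⟨_, rfl⟩
  rw [← hDdef] at hD
  -- the key identity
  have hθ'gp : aeval θ' (X (π g) ^ p * TA) = (X a * Qg) ^ p * aeval θ' TA := by
    rw [map_mul, map_pow, aeval_X, hθ'g]
  have hkey : X a ^ p * deletePthPowers p TB =
      X a ^ p * deletePthPowers p (U' ^ p * aeval θ' (deletePthPowers p TA)) +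
        (deletePthPowers p (aeval β E) - deletePthPowers p (aeval β U ^ p * D)) := by
    have h1 : X a ^ p * deletePthPowers p TB = deletePthPowers p (aeval β B.F) := by
      rw [← deletePthPowers_X_pow_mul, hBch]
    have h2 : aeval β (U ^ p * aeval θ A.F) = X a ^ p * (U' ^ p * aeval θ' TA) - aeval β U ^ p * D := by
      rw [map_mul, map_pow, ApproxCoordChange.aeval_aeval, hDdef, ← ApproxCoordChange.aeval_aeval θ' α, hAch, hθ'gp, hU']
      ring
    rw [h1, hrel, map_add, deletePthPowers_add, deletePthPowers_aeval_deletePthPowers, h2, SwapNorm.deletePthPowers_sub',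
      deletePthPowers_X_pow_mul, SwapNorm.deletePthPowers_mul_aeval_deletePthPowers]
    ring
  obtain ⟨E', hE'⟩ : ∃ E' : MvPolynomial (Fin 4) K,
      E' = deletePthPowers p TB - deletePthPowers p (U' ^ p * aeval θ' (deletePthPowers p TA)) := ⟨_, rfl⟩
  have hE'M : X a ^ p * E' ∈ originIdeal K ^ M := by
    rw [hE', mul_sub, hkey, add_sub_cancel_left]
    refine Ideal.sub_mem _ (SwapNorm.deletePthPowers_mem_pow p (SwapNorm.aeval_mem_pow hβ0 hE)) ?_
    exact SwapNorm.deletePthPowers_mem_pow p (Ideal.mul_mem_left _ _ hD)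
  -- linear coefficients of `W`: `λ²·coeff_k W = −coeff_k Q_g`
  have hWk : ∀ k, k ≠ a → lam ^ 2 * coeff (Finsupp.single k 1) W = -coeff (Finsupp.single k 1) (θ (π g)) := by
    intro k hk
    have h := hWlin k
    rw [hQg1 k hk] at h
    have h2 : lam ^ 2 * coeff (Finsupp.single k 1) W = lam * (lam * coeff (Finsupp.single k 1) W) := by ring
    rw [h2, h]
    linear_combination (-coeff (Finsupp.single k 1) (θ (π g))) * hWc
  refine ⟨θ', e', U', E', ?_, ?_, ?_, ?_, ?_, ?_, ?_, mem_pow_sub_of_X_pow_mul_mem hE'M, ?_, ?_, ?_,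
    fun k hk => ?_, fun k hk => ?_⟩
  · rw [hθ'g, he'a]
  · rw [hθ'a', he'a']
  · rw [he'a, hQg0']; exact hlam
  · rw [he'a', map_mul, hεc, ← hw]; exact mul_ne_zero hea' hwne
  · -- `θ⁺(x_{π a})(0) = 0`: the relation `hLa`
    rw [hθ'a, map_sub, map_mul, hεc, constantCoeff_C, ← hw]
    linear_combination (-w) * hLa + b (π a) * hWc
  · -- `θ⁺(x_{π g̃})(0) = 0`: the relation `hLg̃` (inside `Q_g̃(0)`)
    rw [hθ'gt, map_sub, map_mul, hQt0', constantCoeff_C, ← hw]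
    linear_combination b (π gt) * hWc
  · rw [hU', map_mul, hεc, hQg0']; exact mul_ne_zero hU hlam
  · rw [hstepB, hstepA, hE']
    ring
  · rw [he'a, hQg0']
  · rw [he'a', map_mul, hεc, ← hw]
    linear_combination constantCoeff (e a') * hWc
  · -- tangent row of the dropped slot's image
    rw [hθ'a, coeff_sub, coeff_C, if_neg (Ne.symm (Finsupp.single_ne_zero.mpr one_ne_zero)), sub_zero,
      coeff_single_mul_add, hεc, ← hw, coeff_single_eq_zero_of_sub_C_mem hk.symm (hεflat (e a)), zero_mul, add_zero]
    have h := hWk k hk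
    linear_combination constantCoeff (e a) * h
  · -- tangent row of the other free letter
    rw [hθ'gt, coeff_sub, coeff_C, if_neg (Ne.symm (Finsupp.single_ne_zero.mpr one_ne_zero)), sub_zero,
      coeff_single_mul_add, hQt0', hQt1 k hk, ← hw]
    have h := hWlin k
    rw [hQg1 k hk] at h
    linear_combination (b (π gt) * lam) * h +
      (coeff (Finsupp.single k 1) (θ (π gt)) - b (π gt) * coeff (Finsupp.single k 1) (θ (π g))) * hWc

end SwapTransport

end Summit.ResolutionOfSingularities.ResolutionOfSingularities.Theorems.PIDim4

end
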